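import Mathlib
import Summits.CriticalPhenomena.CardyFormulaZ2.Theorems.CardySelfRefinementDefs
import Summits.CriticalPhenomena.CardyFormulaZ2.Theorems.CardySelfRefinementGradientComparabilityStubCornerHWBAssembly
import Summits.CriticalPhenomena.CardyFormulaZ2.Theorems.CardySelfRefinementGradientComparabilityStubCornerHWBBypass
import HarnessLib

/-!
# Crux `GradientComparability` (stmt-CriticalPhenomena-10269), line `monotone-product-coordinates` —
# stub `stub_cornerHardWayBoxes` (HWB): closed

Route `CardySelfRefinement`; vocabulary from `CardySelfRefinementDefs` (`M`).  The registered stub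
`stub_cornerHardWayBoxes` (uniform supercriticality of the hard-way boxes of aspect ratio `8` under
`M_k(ρ, c₀)` just inside the corner `ρ = 1`; Aizenman–Grimmett essential enhancement) is the
assembly `stub_cornerHardWayBoxes_of_sharedLeInterior` (`…StubCornerHWBAssembly`: bricks (i)
`hardWayBoxes_one_of_half_lt`, (iii′) `hardWayBoxes_segment_integration`, monotonicity in `c`)
applied to the interior-bypass inequality (ii-c) `shared_le_mul_interior` (`…CardySelfRefinementGradientComparabilityStubCornerHWBBypass`).
-/

noncomputable section

namespace Summit.CriticalPhenomena.CardyFormulaZ2.Theorems.CardySelfRefinement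

open scoped Topology
open Filter Set MeasureTheory
open Literature.Probability.LatticeModels Literature.Probability.Percolation
open Literature.Probability.Percolation.QuadCrossing
open Summit.CriticalPhenomena.CardyFormulaZ2.Theses.CardySelfRefinement

/-- **Stub `stub_cornerHardWayBoxes` (HWB).**  For `k = 2, 3` and every `c₀ > 0` there is a depth
`δ > 0` such that for every `ε > 0`, at all large scales `n`, for every translate `w` and every
`ρ ∈ [1 - 2δ, 1]`, the `8n × n` rectangle of the drawing `√2 ℤ² - w` is crossed horizontally and the
`n × 8n` one vertically with `M_k(ρ, c₀)`-probability `≥ 1 - ε` (the assembly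
`stub_cornerHardWayBoxes_of_sharedLeInterior` fed with the interior-bypass inequality `shared_le_mul_interior`). -/
theorem stub_cornerHardWayBoxes : ∀ k : ℕ, k = 2 ∨ k = 3 → ∀ c₀ : ℝ, 0 < c₀ → ∃ δ : ℝ, 0 < δ ∧ ∀ ε : ℝ, 0 < ε → ∃ n₀ : ℕ, ∀ n : ℕ, n₀ ≤ n → ∀ w : ℂ, ∀ ρ ∈ Set.Icc (1 - 2 * δ) 1, 1 - ε ≤ (M k ρ c₀).real (embRectCrossing (fun v => squareLatticeEmbedding.z v - w) (8 * n) n) ∧ 1 - ε ≤ (M k ρ c₀).real (embTBCrossing (fun v => squareLatticeEmbedding.z v - w) n (8 * n)) :=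
  stub_cornerHardWayBoxes_of_sharedLeInterior shared_le_mul_interior

end Summit.CriticalPhenomena.CardyFormulaZ2.Theorems.CardySelfRefinement

end
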